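import Summits.QuantumFields.BalabanUV.T4Continuum.Support.NE7RelPlaqCodifferentialDock
import HarnessLib

/-!
# NE7RelPlaqCodifferentialBounds — F122 IN THE FORM THE ASSEMBLER CONSUMES: the configuration `U′` (= `W e^{Z}` = E′'s `U^{u}`) is a VARIABLE with the equation
# `U′ = vary W Z 1` as a hypothesis, and the flux-divergence radii `j_U ≥ ‖covDiv 1 U′‖`, `j_W ≥ ‖covDiv 1 W‖` ((1.2), (1.9) TYPE) are HYPOTHESES:
# `‖Σ_μ ∇^†_{W,μ}[(W e^{Z})(∂p)·W(∂p)⁻¹ − 1](x)‖ ≤ j_U + j_W + d·(2(e^ρ−1)ε + 2εa + 2a²(2+a) + 2ε²(2+ε))`; file 53b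

Cell `pub-balaban`, rung (B)+1 sub-cell t4, lineage `b2b-balaban-t4-ne7-p1` (CRUX PROVER NE7 #1 = OWNER of row NE7), generation 79; memo
`t4/b2b-balaban-t4-ne7-p1-g79/GRADIENT-LETTER.md` §2 (kernel note).  File F122b (over F122 `NE7RelPlaqCodifferentialDock`: its per-direction algebra `regroup_lt`, `regroup_gt`,
`norm_regroup_le`, `norm_inv_add_sub_le` BY NAME; the END re-assembled).
WHY (a kernel reason, recorded honestly).  F122's END displays `‖covDiv 1 (vary W Z 1) ν x‖` in its conclusion.  Lit-balaban's `B8Ineq132.covDiv` is typed over a general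
normed algebra `𝔸`, and when `𝔸` is INFERRED from the argument `vary W Z 1` the elaborated instance path for `(Matrix n n ℂ)ˣ` differs from the one a consumer's hypothesis
`‖covDiv 1 U ν x‖ ≤ j_U` carries; unifying the two forms unfolds the normed-ring structure of `Matrix n n ℂ` and exceeds the default heartbeat budget (observed: `rfl` on two
copies of `covDiv 1 (vary W Z 1) ν x` times out, while `covDiv (𝔸 := Matrix n n ℂ) 1 …` is instant).  THIS file states the same estimate with `U′` a bound VARIABLE (so every
`covDiv 1 U′` is elaborated at the binder's type, exactly as the consumer's `covDiv 1 (U^{u})`) and with the radii as hypotheses — no `covDiv` term is left for the consumer to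
re-elaborate.  Mathematics identical to F122 (transport defect `2(e^ρ−1)ε`, inversion defects `2a²(2+a)`, `2ε²(2+ε)`, products `2εa`; nothing for `μ = ν`).
WHAT ([folklore]; 0 def, 0 sorry).  **`norm_codiff_relPlaq_le_of_covDiv_bounds`**.
HONEST FRAMING (page 1): elementary lattice ∕ Banach-algebra analysis of OUR objects docked to lit-balaban's typed (1.2); the radii `j_U`, `j_W` are HYPOTHESES; nothing of
Bałaban's asserted; NOT ONE-STEP, NOT NE7; spine 0∕9; finite T⁴ rung (B)+1 — NOT infinite volume, NOT mass gap, NOT `BetaPertH`, NOT Clay.  Continuum YM on T⁴ ⇐ BetaPertH ∧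
nine spine estimates (0/9 proved); BetaPertH ⇐ (D1) ∧ (D4) ∧ CAP+tail; G-an2-4 gates asym, D1 and NE2/3/4.
-/

set_option autoImplicit false

open scoped BigOperators Matrix Matrix.Norms.L2Operator
open NormedSpace Finset

namespace Summit.QuantumFields.BalabanUV.T4Continuum.NE7RelPlaqCodifferentialBounds

open Literature.MathematicalPhysics.QuantumFieldTheory.Balaban1983to89
open B7Prop1Explicit B7Prop2Explicit
open B7Eq78Linearization (conjR conjR_apply)
open B8Ineq132 (covDiv plaqF)
open T4AveragingDeficitWall (Ad IsUnitaryCfg IsSkewDir SmallField vary)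
open T4AveragingDeficitNonAbelian (Ad_mul Ad_sub)
open AveragingDeficitTransport (norm_Ad_of_unitary mem_U1_of_unitary)
open AveragingDeficitNearIdentity (Ad_one Ad_add norm_Ad_sub_le)
open SkeletonPrecompTools (Ad_apply_one)
open NE3CovariantCalculus (cDstar)
open NE7GradientCurrencyCovariant (covDiv_one_eq_sum_ite norm_inv_sub_inv_add_sub_le hol_plaqWord_swap')
open MinimalActionClassSix (conjR_eq_Ad)
open NE7RelPlaqCodifferentialDock (regroup_lt regroup_gt norm_regroup_le)

noncomputable section

variable {d : ℕ} {n : Type*} [Fintype n] [DecidableEq n]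

/-! ## The END with the configuration `U′` ABSTRACT and the flux-divergence radii as HYPOTHESES -/

/-- **THE RELATIVE-PLAQUETTE DATUM AGAINST THE FLUX-DIVERGENCE RADII, CONFIGURATION ABSTRACT.**  For unitary `W` with `SmallField W a`, a skew `Z` with `‖Z‖ ≤ ρ`, a
configuration `U′` with `U′ = vary W Z 1` (given as a VARIABLE: the consumer's `U′ = U^{u}` from E′, so that (1.2) `covDiv 1 U′` is elaborated at the consumer's own type and
its gauge invariance `‖covDiv 1 U^{u}‖ = ‖covDiv 1 U‖` applies verbatim), `SmallField U′ ε`, and radii `‖covDiv 1 U′ ν x‖ ≤ j_U`, `‖covDiv 1 W ν x‖ ≤ j_W` everywhere: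
`‖Σ_μ ∇^†_{W,μ}[(W e^{Z})(∂p_{μν})·W(∂p_{μν})⁻¹ − 1](x)‖ ≤ j_U + j_W + d·(2(e^ρ−1)ε + 2εa + 2a²(2+a) + 2ε²(2+ε))` — the form F121∕F123 consume. [folklore] -/
theorem norm_codiff_relPlaq_le_of_covDiv_bounds [Nonempty n] {W : Site d → Fin d → (Matrix n n ℂ)ˣ} (hW : IsUnitaryCfg W) {a : ℝ} (ha : 0 ≤ a) (hWa : SmallField W a)
    {Z : Site d → Fin d → Matrix n n ℂ} (hZs : IsSkewDir Z) {ρ : ℝ} (hZ : ∀ y κ, ‖Z y κ‖ ≤ ρ)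
    {U' : Site d → Fin d → (Matrix n n ℂ)ˣ} (hU' : U' = vary W Z 1) {ε : ℝ} (hε : 0 ≤ ε) (hUε : SmallField U' ε)
    {jU jW : ℝ} (hjU : ∀ (ν : Fin d) (x : Site d), ‖covDiv 1 U' ν x‖ ≤ jU) (hjW : ∀ (ν : Fin d) (x : Site d), ‖covDiv 1 W ν x‖ ≤ jW)
    (x : Site d) (ν : Fin d) :
    ‖∑ μ, cDstar W μ (fun y => ((hol (vary W Z 1) y (plaqWord μ ν) : (Matrix n n ℂ)ˣ) : Matrix n n ℂ)
        * (((hol W y (plaqWord μ ν))⁻¹ : (Matrix n n ℂ)ˣ) : Matrix n n ℂ) - 1) x‖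
      ≤ jU + jW + d * (2 * (Real.exp ρ - 1) * ε + 2 * (ε * a) + 2 * (a * (2 + a) * a) + 2 * (ε * (2 + ε) * ε)) := by
  classical
  letI : NormedAlgebra ℚ (Matrix n n ℂ) := NormedAlgebra.restrictScalars ℚ ℝ (Matrix n n ℂ)
  rw [← hU']
  -- unitarity of `U′ = W e^{Z}` and of the exponential factors
  have hEu : ∀ (y : Site d) (κ : Fin d), expUnit (((1 : ℝ) : ℂ) • Z y κ) ∈ unitaryUnits (Matrix n n ℂ) := fun y κ => by
    rw [mem_unitaryUnits, val_expUnit, Complex.ofReal_one, one_smul]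
    exact NormedSpace.exp_mem_unitary_of_mem_skewAdjoint (hZs y κ)
  have hU'u : IsUnitaryCfg U' := by rw [hU']; exact fun y κ => (unitaryUnits _).mul_mem (hW y κ) (hEu y κ)
  -- the plaquette data
  have hPa : ∀ (y : Site d) (μ : Fin d), ‖((hol W y (plaqWord μ ν) : (Matrix n n ℂ)ˣ) : Matrix n n ℂ) - 1‖ ≤ a :=
    fun y μ => NE7CovariantHodgeBond.norm_hol_plaqWord_sub_one_le ha hWa y μ ν
  have hSε : ∀ (y : Site d) (μ : Fin d), ‖((hol U' y (plaqWord μ ν) : (Matrix n n ℂ)ˣ) : Matrix n n ℂ) - 1‖ ≤ ε :=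
    fun y μ => NE7CovariantHodgeBond.norm_hol_plaqWord_sub_one_le hε hUε y μ ν
  have hinv : ∀ {Q : (Matrix n n ℂ)ˣ} {c : ℝ}, Q ∈ unitaryUnits (Matrix n n ℂ) → ‖(Q : Matrix n n ℂ) - 1‖ ≤ c →
      ‖((Q⁻¹ : (Matrix n n ℂ)ˣ) : Matrix n n ℂ) - 1‖ ≤ c := fun hQ hc => (norm_inv_sub_one_le (mem_U1_of_unitary hQ)).trans hc
  -- the reference sums (1.2) for `U′` and `W`
  set cU : Fin d → Matrix n n ℂ := fun μ =>
    if μ < ν then conjR (U' (x - e μ) μ)⁻¹ (plaqF U' μ ν (x - e μ)) - plaqF U' μ ν x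
      else if ν < μ then -(conjR (U' (x - e μ) μ)⁻¹ (plaqF U' ν μ (x - e μ)) - plaqF U' ν μ x) else 0 with hcU
  set cW : Fin d → Matrix n n ℂ := fun μ =>
    if μ < ν then conjR (W (x - e μ) μ)⁻¹ (plaqF W μ ν (x - e μ)) - plaqF W μ ν x
      else if ν < μ then -(conjR (W (x - e μ) μ)⁻¹ (plaqF W ν μ (x - e μ)) - plaqF W ν μ x) else 0 with hcW
  have hsumU : covDiv 1 U' ν x = ∑ μ, cU μ := covDiv_one_eq_sum_ite U' ν x
  have hsumW : covDiv 1 W ν x = ∑ μ, cW μ := covDiv_one_eq_sum_ite W ν x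
  set t : Fin d → Matrix n n ℂ := fun μ => cDstar W μ (fun y => ((hol U' y (plaqWord μ ν) : (Matrix n n ℂ)ˣ) : Matrix n n ℂ)
        * (((hol W y (plaqWord μ ν))⁻¹ : (Matrix n n ℂ)ˣ) : Matrix n n ℂ) - 1) x with ht
  -- the constant
  set K : ℝ := 2 * (Real.exp ρ - 1) * ε + 2 * (ε * a) + 2 * (a * (2 + a) * a) + 2 * (ε * (2 + ε) * ε) with hK
  have hρ0 : 0 ≤ ρ := (norm_nonneg _).trans (hZ x ν)
  have hr0 : 0 ≤ Real.exp ρ - 1 := by have := Real.one_le_exp hρ0; linarith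
  have hK0 : 0 ≤ K := by positivity
  -- per direction
  have hterm : ∀ μ : Fin d, ‖t μ - cU μ + cW μ‖ ≤ K := by
    intro μ
    -- the units at play
    have hA : (W (x - e μ) μ)⁻¹ ∈ unitaryUnits (Matrix n n ℂ) := (unitaryUnits _).inv_mem (hW _ _)
    have hE : (expUnit (((1 : ℝ) : ℂ) • Z (x - e μ) μ))⁻¹ ∈ unitaryUnits (Matrix n n ℂ) := (unitaryUnits _).inv_mem (hEu _ _)
    have hEr : ‖(((expUnit (((1 : ℝ) : ℂ) • Z (x - e μ) μ))⁻¹ : (Matrix n n ℂ)ˣ) : Matrix n n ℂ) - 1‖ ≤ Real.exp ρ - 1 := by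
      rw [val_inv_expUnit, val_expUnit, Complex.ofReal_one, one_smul]
      refine (norm_exp_sub_one_le_of_norm_le (le_refl ‖-Z (x - e μ) μ‖)).1.trans ?_
      rw [norm_neg]
      exact sub_le_sub_right (Real.exp_le_exp.mpr (hZ _ _)) 1
    have hB : (U' (x - e μ) μ)⁻¹ = (expUnit (((1 : ℝ) : ℂ) • Z (x - e μ) μ))⁻¹ * (W (x - e μ) μ)⁻¹ := by
      rw [hU']; unfold vary; rw [mul_inv_rev]
    have hb := norm_regroup_le hA hE (hSε x μ) (hSε (x - e μ) μ) (hinv (hol_mem_of hU'u _ _) (hSε x μ)) (hinv (hol_mem_of hU'u _ _) (hSε (x - e μ) μ))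
      (hPa x μ) (hPa (x - e μ) μ) (hinv (hol_mem_of hW _ _) (hPa x μ)) (hinv (hol_mem_of hW _ _) (hPa (x - e μ) μ)) hEr
    rcases lt_trichotomy μ ν with hlt | heq | hgt
    · -- `μ < ν`
      have hcUμ : cU μ = Ad (U' (x - e μ) μ)⁻¹ ((hol U' (x - e μ) (plaqWord μ ν) : (Matrix n n ℂ)ˣ) : Matrix n n ℂ)
          - ((hol U' x (plaqWord μ ν) : (Matrix n n ℂ)ˣ) : Matrix n n ℂ) := by
        rw [hcU]; simp only [if_pos hlt, conjR_eq_Ad]; rfl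
      have hcWμ : cW μ = Ad (W (x - e μ) μ)⁻¹ ((hol W (x - e μ) (plaqWord μ ν) : (Matrix n n ℂ)ˣ) : Matrix n n ℂ)
          - ((hol W x (plaqWord μ ν) : (Matrix n n ℂ)ˣ) : Matrix n n ℂ) := by
        rw [hcW]; simp only [if_pos hlt, conjR_eq_Ad]; rfl
      rw [hcUμ, hcWμ, hB, ht]
      show ‖(Ad (W (x - e μ) μ)⁻¹ _ - _) - _ + _‖ ≤ K
      rw [regroup_lt]
      refine hb.1.trans ?_
      have h3 : 0 ≤ ε * (2 + ε) * ε := by positivity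
      rw [hK]; linarith
    · -- `μ = ν`: everything vanishes
      subst heq
      have hcUμ : cU μ = 0 := by rw [hcU]; simp only [lt_irrefl, if_false]
      have hcWμ : cW μ = 0 := by rw [hcW]; simp only [lt_irrefl, if_false]
      have htμ : t μ = 0 := by
        rw [ht]
        simp only [cDstar, hol_plaqWord_self, inv_one, Units.val_one, mul_one, sub_self, AveragingDeficitNearIdentity.Ad_zero]
      rw [htμ, hcUμ, hcWμ, sub_zero, add_zero, norm_zero]; exact hK0
    · -- `μ > ν`
      have hcUμ : cU μ = -(Ad (U' (x - e μ) μ)⁻¹ (((hol U' (x - e μ) (plaqWord μ ν))⁻¹ : (Matrix n n ℂ)ˣ) : Matrix n n ℂ)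
          - (((hol U' x (plaqWord μ ν))⁻¹ : (Matrix n n ℂ)ˣ) : Matrix n n ℂ)) := by
        rw [hcU]; simp only [if_neg (lt_asymm hgt), if_pos hgt, conjR_eq_Ad]
        show -(Ad _ (plaqF U' ν μ (x - e μ)) - plaqF U' ν μ x) = _
        unfold plaqF; rw [hol_plaqWord_swap' U' (x - e μ) μ ν, hol_plaqWord_swap' U' x μ ν]
      have hcWμ : cW μ = -(Ad (W (x - e μ) μ)⁻¹ (((hol W (x - e μ) (plaqWord μ ν))⁻¹ : (Matrix n n ℂ)ˣ) : Matrix n n ℂ)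
          - (((hol W x (plaqWord μ ν))⁻¹ : (Matrix n n ℂ)ˣ) : Matrix n n ℂ)) := by
        rw [hcW]; simp only [if_neg (lt_asymm hgt), if_pos hgt, conjR_eq_Ad]
        show -(Ad _ (plaqF W ν μ (x - e μ)) - plaqF W ν μ x) = _
        unfold plaqF; rw [hol_plaqWord_swap' W (x - e μ) μ ν, hol_plaqWord_swap' W x μ ν]
      rw [hcUμ, hcWμ, hB, ht]
      show ‖(Ad (W (x - e μ) μ)⁻¹ _ - _) - _ + _‖ ≤ K
      rw [regroup_gt]
      refine hb.2.trans ?_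
      have h3 : 0 ≤ a * (2 + a) * a := by positivity
      rw [hK]; linarith
  -- assemble: `Σ t = Σ (t − cU + cW) + covDiv U′ − covDiv W`
  have hsplit : ∑ μ, t μ = ∑ μ, (t μ - cU μ + cW μ) + covDiv 1 U' ν x - covDiv 1 W ν x := by
    rw [hsumU, hsumW, Finset.sum_add_distrib, Finset.sum_sub_distrib]; abel
  show ‖∑ μ, t μ‖ ≤ _
  rw [hsplit]
  have h1 : ‖∑ μ, (t μ - cU μ + cW μ)‖ ≤ d * K := by
    refine (norm_sum_le _ _).trans ?_
    calc ∑ μ, ‖t μ - cU μ + cW μ‖ ≤ ∑ _μ : Fin d, K := Finset.sum_le_sum fun μ _ => hterm μ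
      _ = d * K := by rw [Finset.sum_const, Finset.card_univ, Fintype.card_fin, nsmul_eq_mul]
  calc ‖∑ μ, (t μ - cU μ + cW μ) + covDiv 1 U' ν x - covDiv 1 W ν x‖
      ≤ ‖∑ μ, (t μ - cU μ + cW μ) + covDiv 1 U' ν x‖ + ‖covDiv 1 W ν x‖ := norm_sub_le _ _
    _ ≤ (d * K + jU) + jW := add_le_add ((norm_add_le _ _).trans (add_le_add h1 (hjU ν x))) (hjW ν x)
    _ = _ := by rw [hK]; ring

end

end Summit.QuantumFields.BalabanUV.T4Continuum.NE7RelPlaqCodifferentialBounds
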